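import Mathlib.Data.Real.Basic
import Mathlib.Data.Complex.Basic
import Literature.Computability.AlgebraicComplexity.EGOW2018RankMeasures
import HarnessLib
import HarnessLib.Audit

/-!
# EGOW 2018, Conjecture 6.1 (tightness of the homogeneous-rank decomposition) — conjecture leaf

K. Efremenko, A. Garg, R. Oliveira, A. Wigderson, *Barriers for rank methods in arithmetic complexity*,
ITCS 2018 = arXiv:1710.09502, §6, Conjecture 6.1 (p. 17; `lit read arxiv:1710.09502` chunk
p0017.txt:L27–29, context L19–26). Cell val-lit (typer t22, DAG row EGOW2018-A); this is the
LOAD-BEARING declaration of the cell's V4 GAP row for this source.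

Conjectures are not Literature (D-0014): the printed conjecture is filed HERE as an obligation —
`@[conjecture] def EGOW2018_conj61Over (F)` (field a parameter) and its instance
`@[conjecture] def EGOW2018_conj61 : Prop := EGOW2018_conj61Over ℂ` (the paper's setting) — stated,
NEVER asserted, no `_holds`, over the vocabulary
of `Literature/Computability/AlgebraicComplexity/EGOW2018RankMeasures.lean` (symbolic rank
`symbolicRank` = the paper's `rk_{F(x)}`, §2.2/§3; homogeneous rank `homogRank` = `hrk`, Def 3.1).
What the tree PROVES around it: the matching upper bound `hrk(M) ≤ (d + 1) · rk_{F(x)}(M)` for matrices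
of homogeneous degree-`d` polynomials over an infinite field (`EGOW2018_lem33` = Lemma 3.3, via
Lemma 3.2); the conjecture asks whether the factor `d + 1` is tight. The paper's remark that
Derksen–Makam [DM16] give linear matrices (`d = 1`) with `hrk ≥ (2 − ε) r` is context, not part of the
conjecture, and is not typed. HONEST FRAMING: an OPEN conjecture about polynomial matrices; nothing
here bears on `VP ≠ VNP` beyond delimiting how far the decomposition-based rank-method barrier
(`Literature.Barriers.ValiantsHypothesis.RankMethods`) could be sharpened.

## References

* [EfremenkoGargOliveiraWigderson2018] ITCS 2018, LIPIcs 94, 1:1–1:19; arXiv:1710.09502, §6,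
  Conjecture 6.1, p. 17.
-/

-- layout Summits/ValiantsHypothesis/ValiantsHypothesis forces the duplicated namespace component
set_option linter.dupNamespace false

noncomputable section

namespace Summit.ValiantsHypothesis.ValiantsHypothesis.Theorems

open Literature.Computability.AlgebraicComplexity

/-- **EGOW 2018, Conjecture 6.1 over a field `F` — CONJECTURE as printed (OPEN; stated, never
asserted).** "For every `d` and for every `ε` there exist a matrix `M(x)` of homogeneous polynomials of
degree `d` and rank `r` such that `hrk(M(x)) > (d + 1 − ε) r`." Reading of the clauses: rank `r` = the
symbolic rank `rk_{F(x)}(M)` (§3, p. 10: "`M(x)` … of homogeneous polynomials of degree `d` such that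
`rk_{F(x)}(M) = r`"; tree `symbolicRank`, equal to the maximal rank of an evaluation by
`EGOW2018_prop26` / `EGOW2018_lem27`); `hrk` = Def 3.1 (tree `homogRank`); "for every `d`" AS PRINTED,
with no lower bound on `d` in print (the instance `d = 0` holds trivially — a non-zero constant matrix
has `hrk = rk` — so `∀ d` and `∀ d ≥ 1` are equivalent); "for every `ε`" = every real `ε > 0`; the
number of variables `n`, the size `m` and `M` are existentially quantified. The field is a parameter
(the paper's standing field is algebraically closed of characteristic zero, §2.1, in particular
infinite; the printed conjecture is the instance `EGOW2018_conj61` over `ℂ`). Known: `hrk ≤ (d + 1) · rk`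
over infinite fields (`EGOW2018_lem33`). [cite: EfremenkoGargOliveiraWigderson2018, Conj 6.1, p. 17] locator: paper:arxiv-1710.09502 p0017.txt:L27 -/
@[conjecture] def EGOW2018_conj61Over (F : Type*) [Field F] : Prop :=
  ∀ (d : ℕ) (ε : ℝ), 0 < ε →
    ∃ (n m r : ℕ) (M : Matrix (Fin m) (Fin m) (MvPolynomial (Fin n) F)),
      (∀ i j, (M i j).IsHomogeneous d) ∧ symbolicRank M = r ∧
        ((d : ℝ) + 1 - ε) * r < (homogRank M : ℝ)

/-- **EGOW 2018, Conjecture 6.1 — CONJECTURE as printed, in the paper's setting `F = ℂ`** (OPEN;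
stated, never asserted; the closed `Prop` a route may take as `--conditional-on`): for every `d` and
every real `ε > 0` there is a square matrix `M(x)` of homogeneous degree-`d` complex polynomials with
`hrk(M) > (d + 1 − ε) · rk_{ℂ(x)}(M)`. [cite: EfremenkoGargOliveiraWigderson2018, Conj 6.1, p. 17] locator: paper:arxiv-1710.09502 p0017.txt:L27 -/
@[conjecture] def EGOW2018_conj61 : Prop :=
  EGOW2018_conj61Over ℂ

end Summit.ValiantsHypothesis.ValiantsHypothesis.Theorems
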